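import Literature.MathematicalPhysics.QuantumLattice.RingCorrelationsTransfer
import HarnessLib

/-!
# Expectation values of product operators in an open-boundary matrix-product state

Family `hubbard` / spin chains (trunk T-QLATTICE). Companion of `RingCorrelationsTransfer`
(periodic MPS): for the OPEN-boundary matrix-product vector
`ψ_{l,r}(σ) = l ⬝ (A^{σ₀} A^{σ₁} ⋯ A^{σ_{N-1}}) r` (`mpsOpen N A l r`, boundary vectors `l, r ∈ ℂ^D`)
and single-site matrices `G k` (`k : Fin N`), the expectation of the product operator `⨂_k G k` is a
boundary matrix element of the composed generalised transfer operators
`𝔼_g(X) = Σ_{ij} g_{ij} A^j X (A^i)†`: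

* `star_mpsOpen_dotProduct_productOp_mulVec` —
  `⟨ψ_{l,r}, (⨂_k G k) ψ_{l,r}⟩ = Tr (B_l · (𝔼_{G 0} ∘ ⋯ ∘ 𝔼_{G (N-1)}) (r r†))` with the left boundary
  matrix `B_l = l̄ lᵀ` (`vecMulVec (star l) l`) and the right boundary density `r r†`
  (`vecMulVec r (star r)`); site `N-1` innermost;
* `star_mpsOpen_dotProduct_productOp_mulVec'` — the same as a boundary matrix element
  `l ⬝ ((𝔼_{G 0} ⋯ 𝔼_{G (N-1)}) (r r†) l̄)`;
* `sum_star_mpsOpen_dotProduct_productOp_mulVec` — summing the left boundary vector over the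
  standard basis (`Σ_a ē_a e_aᵀ = 1`):
  `Σ_a ⟨ψ_{e_a,r}, (⨂_k G k) ψ_{e_a,r}⟩ = Tr ((𝔼_{G 0} ∘ ⋯ ∘ 𝔼_{G (N-1)}) (r r†))`;
* `sum_star_mpsOpen_dotProduct_mpsOpen` — in particular `Σ_a ‖ψ_{e_a,r}‖² = Tr (𝔼^N (r r†))` with
  `𝔼 = transferOp A` (all `G k = 1`).

These are the transfer-matrix formulas behind variational energy bounds from uniform matrix-product
states on long open segments (the mixture `Σ_a |ψ_{e_a,r}⟩⟨ψ_{e_a,r}|` is the segment state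
propagated from the boundary density `r r†`). Pure linear algebra over `ℂ`; no gauge condition on
`A` is used. No definition and no named fact is introduced.

## References
* M. Fannes, B. Nachtergaele, R. F. Werner, Comm. Math. Phys. 144 (1992) 443, eq. (3.1) and §5
  (expectations of local observables in finitely correlated states via the maps `𝔼_A`).
  [cite: FannesNachtergaeleWernerCMP1992, eq. (3.1)]
* D. Perez-Garcia, F. Verstraete, M. M. Wolf, J. I. Cirac, Quantum Inf. Comput. 7 (2007) 401, §2
  eq. (1) (open-boundary MPS) and §3.2.2 (transfer operators). [cite: PerezGarciaVerstraeteWolfCiracQIC2007, §2]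
-/

noncomputable section

open Matrix

namespace Literature.MathematicalPhysics.QuantumLattice

section QLattice

variable {q D : ℕ}

/-- `Tr ((x yᵀ) M) = y ⬝ (M x)` (trace against a rank-one matrix). [folklore]
[cite: PerezGarciaVerstraeteWolfCiracQIC2007, §2] -/
theorem trace_vecMulVec_mul_eq_dotProduct_mulVec (x y : Fin D → ℂ) (M : Matrix (Fin D) (Fin D) ℂ) :
    (vecMulVec x y * M).trace = y ⬝ᵥ (M *ᵥ x) := by
  simp only [Matrix.trace, Matrix.diag_apply, Matrix.mul_apply, vecMulVec_apply, dotProduct,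
    mulVec, Finset.mul_sum]
  rw [Finset.sum_comm]
  refine Finset.sum_congr rfl fun j _ => Finset.sum_congr rfl fun i _ => ?_
  ring

/-- `(r r†) v = (r† v) r` (a rank-one matrix acting on a vector). [folklore]
[cite: PerezGarciaVerstraeteWolfCiracQIC2007, §2] -/
theorem vecMulVec_star_mulVec (r v : Fin D → ℂ) :
    vecMulVec r (star r) *ᵥ v = (star r ⬝ᵥ v) • r := by
  ext i
  simp only [mulVec, dotProduct, vecMulVec_apply, Pi.smul_apply, Pi.star_apply, smul_eq_mul,
    Finset.sum_mul]
  exact Finset.sum_congr rfl fun j _ => by ring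

/-- `r† (Qᴴ l̄) = conj (l ⬝ Q r)`. [folklore] [cite: PerezGarciaVerstraeteWolfCiracQIC2007, §2] -/
theorem star_dotProduct_conjTranspose_mulVec_star (Q : Matrix (Fin D) (Fin D) ℂ)
    (l r : Fin D → ℂ) :
    star r ⬝ᵥ (Qᴴ *ᵥ star l) = star (l ⬝ᵥ (Q *ᵥ r)) := by
  simp only [dotProduct, mulVec, conjTranspose_apply, Pi.star_apply, star_sum, star_mul',
    Finset.mul_sum]
  rw [Finset.sum_comm]
  refine Finset.sum_congr rfl fun j _ => Finset.sum_congr rfl fun i _ => ?_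
  ring

/-- One word term of the open-boundary expectation: for matrices `P, Q` and boundary vectors
`l, r`, `l ⬝ ((P (r r†) Qᴴ) l̄) = (l ⬝ P r) · conj (l ⬝ Q r)`. [folklore]
[cite: PerezGarciaVerstraeteWolfCiracQIC2007, §2] -/
theorem dotProduct_mulLeftRight_vecMulVec_mulVec_star (P Q : Matrix (Fin D) (Fin D) ℂ)
    (l r : Fin D → ℂ) :
    l ⬝ᵥ ((P * vecMulVec r (star r) * Qᴴ) *ᵥ star l) =
      (l ⬝ᵥ (P *ᵥ r)) * star (l ⬝ᵥ (Q *ᵥ r)) := by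
  rw [Matrix.mul_assoc, ← mulVec_mulVec, ← mulVec_mulVec, vecMulVec_star_mulVec,
    star_dotProduct_conjTranspose_mulVec_star, mulVec_smul, dotProduct_smul, smul_eq_mul, mul_comm]

/-- **Expectation of a product operator in the open-boundary MPS (trace form).** For the
matrix-product vector `ψ(σ) = l ⬝ (A^{σ₀} ⋯ A^{σ_{N-1}}) r` on `Fin N` (`mpsOpen N A l r`) and
single-site matrices `G k`,
`⟨ψ, (⨂_k G k) ψ⟩ = Tr ((l̄ lᵀ) · (𝔼_{G 0} ⋯ 𝔼_{G (N-1)}) (r r†))` with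
`𝔼_g(X) = Σ_{ij} g_{ij} A^j X (A^i)†` (composition of linear maps, site `0` outermost).
Fannes–Nachtergaele–Werner (1992) eq. (3.1); Perez-Garcia–Verstraete–Wolf–Cirac (2007) §2 eq. (1),
§3.2.2. [cite: FannesNachtergaeleWernerCMP1992, eq. (3.1)] -/
theorem star_mpsOpen_dotProduct_productOp_mulVec (N : ℕ) (A : MPSTensor q D) (l r : Fin D → ℂ)
    (G : Fin N → Matrix (Fin q) (Fin q) ℂ) :
    star (mpsOpen N A l r) ⬝ᵥ (productOp G *ᵥ mpsOpen N A l r) =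
      (vecMulVec (star l) l * ((List.ofFn fun k : Fin N =>
        ∑ i : Fin q, ∑ j : Fin q, G k i j • LinearMap.mulLeftRight ℂ (A j, (A i)ᴴ)).prod)
          (vecMulVec r (star r))).trace := by
  -- the left-hand side, expanded over configurations (the amplitudes `mpsOpen … σ` stay folded)
  have hL : star (mpsOpen N A l r) ⬝ᵥ (productOp G *ᵥ mpsOpen N A l r) =
      ∑ σ : TensorIndex (Fin N) q, ∑ τ : TensorIndex (Fin N) q,
        star (mpsOpen N A l r σ) * ((∏ k, G k (σ k) (τ k)) * mpsOpen N A l r τ) := by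
    simp only [dotProduct, mulVec, Pi.star_apply, productOp_apply, Finset.mul_sum]
  -- the right-hand side, expanded over words
  have hword : ∀ σ τ : TensorIndex (Fin N) q,
      (vecMulVec (star l) l * (wordProduct A τ * vecMulVec r (star r) * (wordProduct A σ)ᴴ)).trace =
        mpsOpen N A l r τ * star (mpsOpen N A l r σ) := by
    intro σ τ
    rw [trace_vecMulVec_mul_eq_dotProduct_mulVec, dotProduct_mulLeftRight_vecMulVec_mulVec_star]
    rfl
  rw [hL, prod_ofFn_transferOpGen]
  simp only [LinearMap.sum_apply, LinearMap.smul_apply, LinearMap.mulLeftRight_apply,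
    Matrix.mul_sum, Matrix.mul_smul, Matrix.trace_sum, Matrix.trace_smul, smul_eq_mul, hword]
  refine Finset.sum_congr rfl fun σ _ => Finset.sum_congr rfl fun τ _ => ?_
  ring

/-- The same as a **boundary matrix element**: `⟨ψ, (⨂_k G k) ψ⟩ = l ⬝ ((𝔼_{G 0} ⋯ 𝔼_{G (N-1)}) (r r†) l̄)`.
[cite: FannesNachtergaeleWernerCMP1992, eq. (3.1)] -/
theorem star_mpsOpen_dotProduct_productOp_mulVec' (N : ℕ) (A : MPSTensor q D) (l r : Fin D → ℂ)
    (G : Fin N → Matrix (Fin q) (Fin q) ℂ) :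
    star (mpsOpen N A l r) ⬝ᵥ (productOp G *ᵥ mpsOpen N A l r) =
      l ⬝ᵥ (((List.ofFn fun k : Fin N =>
        ∑ i : Fin q, ∑ j : Fin q, G k i j • LinearMap.mulLeftRight ℂ (A j, (A i)ᴴ)).prod)
          (vecMulVec r (star r)) *ᵥ star l) := by
  rw [star_mpsOpen_dotProduct_productOp_mulVec, trace_vecMulVec_mul_eq_dotProduct_mulVec]

/-- `Σ_a ē_a e_aᵀ = 1` for the standard basis vectors `e_a = Pi.single a 1`. [folklore]
[cite: PerezGarciaVerstraeteWolfCiracQIC2007, §2] -/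
theorem sum_vecMulVec_star_single_single :
    ∑ a : Fin D, vecMulVec (star (Pi.single a (1 : ℂ))) (Pi.single a (1 : ℂ)) =
      (1 : Matrix (Fin D) (Fin D) ℂ) := by
  ext i j
  simp only [Matrix.sum_apply, vecMulVec_apply, Pi.star_apply, Pi.single_apply, Matrix.one_apply]
  by_cases hij : i = j
  · subst hij
    rw [Finset.sum_eq_single i]
    · simp
    · intro b _ hb
      simp [Ne.symm hb]
    · intro h
      exact absurd (Finset.mem_univ i) h
  · rw [if_neg hij]
    refine Finset.sum_eq_zero fun a _ => ?_
    by_cases hia : i = a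
    · subst hia
      simp [Ne.symm hij]
    · simp [hia]

/-- **Summing the left boundary vector over the standard basis**: the mixture of the open MPS
vectors `ψ_{e_a, r}` has product-operator expectation
`Σ_a ⟨ψ_{e_a,r}, (⨂_k G k) ψ_{e_a,r}⟩ = Tr ((𝔼_{G 0} ⋯ 𝔼_{G (N-1)}) (r r†))`.
Fannes–Nachtergaele–Werner (1992) eq. (3.1), §5. [cite: FannesNachtergaeleWernerCMP1992, eq. (3.1)] -/
theorem sum_star_mpsOpen_dotProduct_productOp_mulVec (N : ℕ) (A : MPSTensor q D) (r : Fin D → ℂ)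
    (G : Fin N → Matrix (Fin q) (Fin q) ℂ) :
    ∑ a : Fin D, star (mpsOpen N A (Pi.single a 1) r) ⬝ᵥ
        (productOp G *ᵥ mpsOpen N A (Pi.single a 1) r) =
      (((List.ofFn fun k : Fin N =>
        ∑ i : Fin q, ∑ j : Fin q, G k i j • LinearMap.mulLeftRight ℂ (A j, (A i)ᴴ)).prod)
          (vecMulVec r (star r))).trace := by
  simp only [star_mpsOpen_dotProduct_productOp_mulVec]
  rw [← Matrix.trace_sum, ← Finset.sum_mul, sum_vecMulVec_star_single_single, Matrix.one_mul]

/-- **Norms**: `Σ_a ‖ψ_{e_a,r}‖² = Tr (𝔼^N (r r†))` with the transfer operator `𝔼 = transferOp A`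
(the case `G k = 1`). Fannes–Nachtergaele–Werner (1992) §2 eq. (2.4), eq. (3.1).
[cite: FannesNachtergaeleWernerCMP1992, eq. (3.1)] -/
theorem sum_star_mpsOpen_dotProduct_mpsOpen (N : ℕ) (A : MPSTensor q D) (r : Fin D → ℂ) :
    ∑ a : Fin D, star (mpsOpen N A (Pi.single a 1) r) ⬝ᵥ mpsOpen N A (Pi.single a 1) r =
      (((transferOp A) ^ N) (vecMulVec r (star r))).trace := by
  have h := sum_star_mpsOpen_dotProduct_productOp_mulVec N A r
    (fun _ => (1 : Matrix (Fin q) (Fin q) ℂ))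
  rw [productOp_one] at h
  simp only [Matrix.one_mulVec] at h
  rw [h, transferOpGen_one, List.ofFn_const, List.prod_replicate]

end QLattice

end Literature.MathematicalPhysics.QuantumLattice

end
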